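import Summits.QuantumFields.YangMills.Theorems.BalabanUVNodesN07SymGaugeWithinBlock
import HarnessLib

/-!
# N07 [B11] (= [15] = [Balaban1985Variational]) Sect. F — MODULE 126: **THE STAIR FAMILY's PAIRWISE AND SMALL-DIAMETER LETTERS FROM THE BLOCK's BOX PLAQUETTES, GAUGE-FREE**
# ([I] (0.3)∕(0.5)∕(0.11); [6] pp. 79–80) — the (Σ-c2) supplier of the N05-REC → K0-road φ-junction (dag-n07-w3 g13 Q3, pub-ymgap bus 2026-08-30 01:10Z): the hypotheses
# `FamilySmall δ (stairFamily W y r)` and `∀ i, dist1 (stairFamily W y r i * (stairFamily W y r 0)⁻¹) ≤ δ′` of ✓`…N07SymAxialTreeDefect.dist1_stairFamily_le_of_axialGauge_symCd`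
# at `δ′ := 2·(d⌊(L−1)∕2⌋·((d−1)(L−1)·a))`, from NOTHING BUT the level-`m` plaquette letter `a` on the box of the block `B(castSite t)`

Cell `pub-ymgap`, seat `pub-ymgap-dag-n07-e` g32 (FAN-OUT §N07 row s3; LANE OWNER of the K0 road chart side).  `--kind proof --supports stmt-QuantumFields-20541 --as helper` (K0⁷);
count-neutral; THEOREMS ONLY (0 `def`); generic `P`, `SU(N)`.  [15] = [Balaban1985Variational]; [6] = [Balaban1985RegularSpaces]; [I] = [Balaban1987RG1]; [3] = [Balaban1985Averaging].

WHY.  Road (B′)'s first factor at the junction is `a = τ·X⁻¹` with `τ` the transformation from the crown's RADIAL axial tower (`InAxOneZ`) to the def of record's `symCd`-axial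
carrier; ✓p753816 ∕ ✓p754021 ∕ p754286 (dag-n07-w3) reduce its (167)-rows to ONE torus-side letter per level `n`: the stair family of `W := M^n(U^{w_s})` at the window blocks is
`δ_F`-small and pairwise within `δ′(n)`, `δ′` geometric in `n`.  Both hypotheses are GAUGE INVARIANT in `W` (MODULE 86: `stairFamily_gaugeAct` conjugates every pairwise product
`U(Γ^σ)·U(Γ^τ)⁻¹` by `u(emb y)`; `familySmall_stairFamily_gaugeAct_iff`), so they are letters of the PLAQUETTES of `W` — which for `W = M^n(U^{w_s})` are those of `M^n(U)`
conjugated, i.e. the datum's own row (17) `ε_n·η_n²`, geometric in `n`.  The tree had the step only (i) GLOBALLY (✓`…N09GaugeFixingTermContinuousOnAdmissible.dist1_stairHol_mul_inv_le`,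
`PlaqSmall a U` on the whole level) and (ii) LOCALLY but UN-EXPORTED (the `hstair` step inside ✓`…N07SymGaugeWithinBlock.dist1_le_of_axialGauge_sym_box`).  THIS FILE exports the
local form: in pv26's box gauge `g` of the block (rooted so that `g(emb y) = 1`) every in-block bond of `W^g` is `τ := (d−1)(L−1)·a`-close to `1`
(`dist1_gaugeAct_axialGauge_le_of_mem_boxBonds`) and every centre staircase is a product of `≤ d⌊(L−1)∕2⌋` in-block bonds, hence within `σ′ := d⌊(L−1)∕2⌋·τ` of `1`; pairwise
products and the small-diameter guard are then read off `W^g` and transported to `W` by gauge invariance — NO axial-gauge hypothesis on `W`, NO Landau copy, NO budget.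

WHAT IS PROVED (sorry-free; axioms standard).
§1 ★ `exists_boxGauge_stairFamily_near_one` — `∃ g`, `g (emb (castSite t)) = 1`, every bond with both ends in `B(castSite t)` has `dist1 (W^g b) ≤ τ`, and every centre stair of
   `W^g` is within `σ′` of `1` (the exported `hstair` of ✓`…N07SymGaugeWithinBlock`, proof verbatim).
§2 ★★ `dist1_stairFamily_pairwise_le_of_boxPlaqs` — `dist1 (stairFamily W (castSite t) r i * (stairFamily W (castSite t) r k)⁻¹) ≤ 2·σ′` for EVERY `W` (gauge-free).
§3 ★★ `familySmall_stairFamily_of_boxPlaqs` — `2·σ′ < δ ⇒ FamilySmall δ (stairFamily W (castSite t) r)` for EVERY `δ` (Federbush's `δ_F`, the (0.4) guard `δ_N`, …).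
HONEST SCOPE: elementary holonomy bookkeeping over pv26's box axial gauge ([6] pp. 79–80's argument); nothing of [15]∕[6]∕[3]∕[I] analysis asserted; the junction's knit, (σ1) and
(Σ-c3) are NOT here; `HThm4RecSym152PhiEG` ∕ `HThm4Rec*` stay CONDITIONAL, inhabited by nobody; K0⁷ ∕ K1⁹ NOT closed; N07 NOT discharged; counts unmoved (typed 28∕28 · discharged 8∕28);
one finite 𝕋⁴ programme at fixed ε — the route closes the conditional finite-𝕋⁴ rung `BalabanLadder.UV` ONLY; the YM mass gap (Clay) is NOT proved by any of this; nothing continuum ∕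
ℝ⁴ ∕ OS.  No `def`, no `instance`, no `notation`, no `sorry`.

References: [I] (0.3) p. 252, (0.5)–(0.11) p. 253; [6] (1.15) p. 78, pp. 79–80 (proof of Lemma 1); [3] (11) p. 19, (19)–(20) p. 21; [15] (147) p. 301, (152) p. 301.
-/

set_option autoImplicit false

noncomputable section

open scoped BigOperators Matrix.Norms.L2Operator

namespace Summit.QuantumFields.YangMills.BalabanUVNodes.N07StairFamilyLettersOfBoxPlaquettes

open Literature.MathematicalPhysics.QuantumFieldTheory.Balaban1983to89
open Literature.MathematicalPhysics.QuantumFieldTheory.Balaban1983to89.Node00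
open T4Continuum (T4Family stairWord walk holAt)
open T4AxialGaugeSmallField (castSite castSite_apply boxBonds boxPlaqs axialGauge dist1_gaugeAct_axialGauge_le_of_mem_boxBonds)
open B14DomainGeom (Pt)
open GaugeField (gaugeAct)
open FederbushMean (dist1_SU_eq)
open BlockAveraging (off off_bounds)
open B10Eq27TorusAxialLog (holT holT_eq_holAt)
open Summit.QuantumFields.YangMills.Theorems.K0UniformFluxConfig (dist1_holAt_le_length_mul)
open Summit.QuantumFields.YangMills.BalabanUVNodes.N07SymContourData (permEnum stairFamily stairFamily_gaugeAct)
open Summit.QuantumFields.YangMills.BalabanUVNodes.N07ShearedFrameLetters (dist1_mul_inv_le)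
open Summit.QuantumFields.YangMills.BalabanUVNodes.N07ShearSizeTopBox (mem_boxBonds_of_ends_mem_box)
open Summit.QuantumFields.YangMills.BalabanUVNodes.N07AveragedPlaquetteCornerBlocks (mem_blowDown_of_blockOf_mem_box)

variable {P : Params} {N : ℕ} [NeZero N] {m : ℕ}

/-! ## §1  pv26's box gauge of one block, rooted at the centre: in-block bonds `τ`-close, centre stairs `σ′`-close -/

/-- ★ **THE ROOTED BOX GAUGE OF A BLOCK** ([6] pp. 79–80; pv26's `T4AxialGaugeSmallField.axialGauge` on the box `[L·t, L·t + (L−1)]` of `B(castSite t)`, re-rooted at the centre):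
if every level-`m` plaquette based in the box is within `a` of `1` (`0 ≤ a`, `L < N_m`), there is a gauge transformation `g` with `g (emb (castSite t)) = 1` in which every bond with
both ends in the block is within `τ := (d−1)(L−1)·a` of `1` and every centre staircase transporter `(W^g)(Γ^σ_{y, x})`, `x = blockSite y r`, is within `σ′ := d⌊(L−1)∕2⌋·τ` of `1`
(a staircase is a product of at most `d⌊(L−1)∕2⌋` in-block bonds).  The un-exported `hstair` step of ✓`…N07SymGaugeWithinBlock.dist1_le_of_axialGauge_sym_box`, verbatim.
[cite: Balaban1985RegularSpaces, (1.15) p.78, pp.79–80; Balaban1987RG1, (0.3) p.252; Balaban1985Averaging, (19)–(20) p.21] -/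
theorem exists_boxGauge_stairFamily_near_one (hm : m + 1 ≤ P.m + P.K) (W : GaugeField P m (SU N)) {a : ℝ} (ha : 0 ≤ a) (hN : P.L < P.sitesPerDir m) (t : Fin P.d → ℤ)
    (hplaq : PlaqSmallOn (boxPlaqs (fun i => (P.L : ℤ) * t i) (fun i => (P.L : ℤ) * t i + ((P.L : ℤ) - 1))) a W) :
    ∃ g : GaugeTransf P m (SU N), g (emb (castSite t : Site P (m + 1))) = 1 ∧
      (∀ b : PBond P m, blockOf b.src = (castSite t : Site P (m + 1)) → blockOf b.tgt = (castSite t : Site P (m + 1)) →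
        dist1 (gaugeAct g W b) ≤ (((P.d - 1 : ℕ) : ℝ) * ((P.L - 1 : ℕ) : ℝ)) * a) ∧
      ∀ (r : Fin P.d → Fin P.L) (k : Fin ((Nat.factorial P.d - 1) + 1)),
        ‖((stairFamily (gaugeAct g W) (castSite t) r k : SU N) : Matrix (Fin N) (Fin N) ℂ) - 1‖ ≤
          ((P.d * ((P.L - 1) / 2) : ℕ) : ℝ) * ((((P.d - 1 : ℕ) : ℝ) * ((P.L - 1 : ℕ) : ℝ)) * a) := by
  classical
  set lo : Fin P.d → ℤ := fun i => (P.L : ℤ) * t i with hlo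
  set hi : Fin P.d → ℤ := fun i => (P.L : ℤ) * t i + ((P.L : ℤ) - 1) with hhi
  set y : Site P (m + 1) := castSite t with hy
  set Gy : GaugeTransf P m (SU N) := axialGauge W lo hi with hGy
  set g : GaugeTransf P m (SU N) := fun x => (Gy (emb y))⁻¹ * Gy x with hg
  set τ : ℝ := ((P.d - 1 : ℕ) : ℝ) * ((P.L - 1 : ℕ) : ℝ) * a with hτdef
  have hτ : 0 ≤ τ := by positivity
  have hL1 : 1 ≤ P.L := P.L_pos
  -- box numerics: one block, `L` labels per direction, non-wrapping
  have hn : ∀ κ, hi κ ≤ lo κ + ((P.L - 1 : ℕ) : ℤ) := fun κ => by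
    simp only [hhi, hlo]; push_cast [Nat.cast_sub hL1]; linarith
  have hnN : P.L - 1 < P.sitesPerDir m := by omega
  have hN' : ∀ κ, hi κ + 1 - lo κ < P.sitesPerDir m := fun κ => by
    simp only [hhi, hlo]
    have : (P.L : ℤ) < (P.sitesPerDir m : ℤ) := by exact_mod_cast hN
    linarith
  -- the bonds with both ends in `B(y)` are box bonds
  have hbox : ∀ b' : PBond P m, blockOf b'.src = y → blockOf b'.tgt = y → b' ∈ boxBonds lo hi := by
    intro b' h1 h2
    have hs : b'.src ∈ (castSite '' Set.Icc lo hi : Set (Site P m)) := by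
      have := mem_blowDown_of_blockOf_mem_box hm (⟨t, ⟨le_rfl, le_rfl⟩, h1.symm⟩ : blockOf b'.src ∈ (castSite '' Set.Icc t t : Set (Site P (m + 1))))
      simpa [hlo, hhi] using this
    have ht' : b'.tgt ∈ (castSite '' Set.Icc lo hi : Set (Site P m)) := by
      have := mem_blowDown_of_blockOf_mem_box hm (⟨t, ⟨le_rfl, le_rfl⟩, h2.symm⟩ : blockOf b'.tgt ∈ (castSite '' Set.Icc t t : Set (Site P (m + 1))))
      simpa [hlo, hhi] using this
    exact mem_boxBonds_of_ends_mem_box hN' hs ht'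
  -- every bond of `B(y)` of `W^g` is `τ`-close to `1`
  have hWg : ∀ b' : PBond P m, blockOf b'.src = y → blockOf b'.tgt = y → dist1 (gaugeAct g W b') ≤ τ := by
    intro b' h1 h2
    have hconj : gaugeAct g W b' = (Gy (emb y))⁻¹ * gaugeAct Gy W b' * ((Gy (emb y))⁻¹)⁻¹ := by
      show (Gy (emb y))⁻¹ * Gy b'.src * W b' * ((Gy (emb y))⁻¹ * Gy b'.tgt)⁻¹ = (Gy (emb y))⁻¹ * (Gy b'.src * W b' * (Gy b'.tgt)⁻¹) * ((Gy (emb y))⁻¹)⁻¹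
      group
    rw [hconj, GaugeGroup.dist1_conj]
    exact dist1_gaugeAct_axialGauge_le_of_mem_boxBonds W subset_rfl hplaq ha hn hnN (hbox b' h1 h2)
  have hg1 : g (emb y) = 1 := by show (Gy (emb y))⁻¹ * Gy (emb y) = 1; exact inv_mul_cancel _
  refine ⟨g, hg1, hWg, fun r k => ?_⟩
  -- the centre stairs of `W^g` are within `σ′ = d⌊(L−1)∕2⌋·τ`
  rw [← dist1_SU_eq]
  show dist1 (holT (gaugeAct g W) (emb y) (stairWord (permEnum P k) (off r))) ≤ ((P.d * ((P.L - 1) / 2) : ℕ) : ℝ) * τ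
  rw [holT_eq_holAt]
  have hsteps : ∀ st ∈ walk (emb y) (stairWord (permEnum P k) (off r)), dist1 (gaugeAct g W st.bond) ≤ τ := fun st hst =>
    hWg st.bond (T4Continuum.blockOf_ends_of_mem_stairWalk hm y r _ st hst).1 (T4Continuum.blockOf_ends_of_mem_stairWalk hm y r _ st hst).2
  refine (dist1_holAt_le_length_mul _ _ hsteps).trans ?_
  have hlen : ((walk (emb y) (stairWord (permEnum P k) (off r))).length : ℝ) ≤ ((P.d * ((P.L - 1) / 2) : ℕ) : ℝ) := by
    rw [BlockAveragingEMLLinearised.length_walk]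
    exact_mod_cast LatticeWordStokes.length_stairWord_le _ (off r) ((P.L - 1) / 2) fun ν => by
      have h := off_bounds r ν
      omega
  exact mul_le_mul_of_nonneg_right hlen hτ

/-! ## §2  The pairwise letter, gauge-free -/

/-- ★★ **THE STAIR FAMILY's PAIRWISE LETTER FROM THE BOX PLAQUETTES, FOR EVERY FIELD** ([I] (0.3)∕(0.5); lattice Stokes on the loop `Γ^σ·(Γ^τ)⁻¹`, here via the rooted box gauge):
if every level-`m` plaquette based in the box of `B(castSite t)` is within `a` of `1` (`0 ≤ a`, `L < N_m`), then for every block offset `r` and every two stair orders `i, k`: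
`dist1 (W(Γ^{σ_i}_{y,x}) · W(Γ^{σ_k}_{y,x})⁻¹) ≤ 2·(d⌊(L−1)∕2⌋·((d−1)(L−1)·a))`.  NO gauge hypothesis on `W`: the pairwise products of `W` and of `W^g` COINCIDE when `g(emb y) = 1`
(MODULE 86 `stairFamily_gaugeAct`: both stairs end at `x`, the factors `g(x)⁻¹·g(x)` cancel). [cite: Balaban1987RG1, (0.3) p.252, (0.5) p.253; Balaban1985Averaging, (11) p.19, (19)–(20) p.21; Balaban1985RegularSpaces, pp.79–80] -/
theorem dist1_stairFamily_pairwise_le_of_boxPlaqs (hm : m + 1 ≤ P.m + P.K) (W : GaugeField P m (SU N)) {a : ℝ} (ha : 0 ≤ a) (hN : P.L < P.sitesPerDir m) (t : Fin P.d → ℤ)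
    (hplaq : PlaqSmallOn (boxPlaqs (fun i => (P.L : ℤ) * t i) (fun i => (P.L : ℤ) * t i + ((P.L : ℤ) - 1))) a W)
    (r : Fin P.d → Fin P.L) (i k : Fin ((Nat.factorial P.d - 1) + 1)) :
    dist1 (stairFamily W (castSite t) r i * (stairFamily W (castSite t) r k)⁻¹) ≤
      2 * (((P.d * ((P.L - 1) / 2) : ℕ) : ℝ) * ((((P.d - 1 : ℕ) : ℝ) * ((P.L - 1 : ℕ) : ℝ)) * a)) := by
  obtain ⟨g, hg1, -, hstair⟩ := exists_boxGauge_stairFamily_near_one hm W ha hN t hplaq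
  -- the pairwise products of `W` are those of `W^g`
  have hrel : stairFamily W (castSite t) r i * (stairFamily W (castSite t) r k)⁻¹ =
      stairFamily (gaugeAct g W) (castSite t) r i * (stairFamily (gaugeAct g W) (castSite t) r k)⁻¹ := by
    have hi := congrFun (stairFamily_gaugeAct g W (castSite t) r) i
    have hk := congrFun (stairFamily_gaugeAct g W (castSite t) r) k
    rw [hi, hk, hg1]
    group
  rw [hrel]
  exact dist1_mul_inv_le _ (hstair r) i k

/-! ## §3  The small-diameter guard, gauge-free -/

/-- ★★ **THE STAIR FAMILY IS `δ`-SMALL FROM THE BOX PLAQUETTES, FOR EVERY FIELD AND EVERY RADIUS `δ`** with `2·(d⌊(L−1)∕2⌋·((d−1)(L−1)·a)) < δ` ([I] p. 253 «defined on sets … with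
sufficiently small diameters»: the group-average guard — Federbush's `δ_F`, the (0.4) guard `δ_N` — is INACTIVE on blocks with `a`-small plaquettes). [cite: Balaban1987RG1, (0.5) p.253, (0.11) p.253; Balaban1985RegularSpaces, pp.79–80] -/
theorem familySmall_stairFamily_of_boxPlaqs (hm : m + 1 ≤ P.m + P.K) (W : GaugeField P m (SU N)) {a : ℝ} (ha : 0 ≤ a) (hN : P.L < P.sitesPerDir m) (t : Fin P.d → ℤ)
    (hplaq : PlaqSmallOn (boxPlaqs (fun i => (P.L : ℤ) * t i) (fun i => (P.L : ℤ) * t i + ((P.L : ℤ) - 1))) a W)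
    {δ : ℝ} (hguard : 2 * (((P.d * ((P.L - 1) / 2) : ℕ) : ℝ) * ((((P.d - 1 : ℕ) : ℝ) * ((P.L - 1 : ℕ) : ℝ)) * a)) < δ) (r : Fin P.d → Fin P.L) :
    FamilySmall δ (stairFamily W (castSite t) r) :=
  fun i k => (dist1_stairFamily_pairwise_le_of_boxPlaqs hm W ha hN t hplaq r i k).trans_lt hguard

end Summit.QuantumFields.YangMills.BalabanUVNodes.N07StairFamilyLettersOfBoxPlaquettes

end
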